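import Literature.Analysis.FluidPDE.LocalTypeIWeakSerrin
import Literature.Analysis.FluidPDE.Seregin2020ScaledEnergyBoundsA
import Literature.Analysis.FluidPDE.LocalTypeILscPressure
import HarnessLib

/-!
# Weak Serrin implies Type I, the `L^∞`-rate case: proof (Albritton–Barker 2019, Lemma 2.5)

Analysis/FluidPDE proof file (everything proved; no definitions, no named facts): the discharge
`albrittonBarker2019_lemma_2_5_rate_holds` of the named fact
`Literature.Analysis.FluidPDE.albrittonBarker2019_lemma_2_5_rate` (`LocalTypeIWeakSerrin.lean`;
D. Albritton, T. Barker, *On local Type I singularities of the Navier–Stokes equations and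
Liouville theorems*, J. Math. Fluid Mech. 21 (2019) = arXiv:1811.00502, **Lemma 2.5** with
Remark 3.2, held: paper:arxiv-1811.00502, §2 read, chunk p0006).

## The printed proof and its rendering

A–B prove Lemma 2.5 ("weak Serrin implies Type I") in two lines (arXiv p. 6): for `δ > 0`
small, `s = p - δ`, `l = q - δ` satisfy the hypotheses of **Lemma 2.6** (Morrey-type
estimates: a suitable weak solution on `Q` one of whose critical quantities
`sup_{Q'⊂Q} A`, `sup C`, `sup E`, `sup M^{s,l}` is finite has `𝐈(Q(R)) < ∞` for `R < 1`;
Seregin 2006/2007, Seregin–Zajaczkowski 2006, printed without proof), and the Lorentz-space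
embedding bounds `M^{s,l}(Q')` by the weak Serrin norm. Lemma 2.6 in turn is Seregin's
iteration: the local energy inequality, the decay estimate for the pressure and an
interpolation inequality with a gain, iterated along the scales `θᵏ r`.

The vendored fact is the endpoint `(p, q) = (∞, 2)` under the POINTWISE rate
`|u(s, y)| ≤ C/√(t - s)` on `Q(z, 1)`. In this case the Morrey/Lorentz step is replaced by
the elementary interpolation (`cknC_le_of_rate`)

  `∫_{B} |u(s)|³ ≤ sup_B |u(s)|^{3/2} |B|^{1/4} (∫_B |u(s)|²)^{3/4}`,
  `∫_{t'-ρ²}^{t'} (t - s)^{-3/4} ds ≤ 4 ρ^{1/2}`  ⟹  `C(Q(z', ρ)) ≤ κ A(Q(z', ρ))^{3/4}`,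

`κ = 4 |B₁|^{1/4} C^{3/2}`, valid on EVERY parabolic sub-ball of `Q(z, 1)` (the gain `3/4 < 1`
is the point: the borderline split `|u|³ ≤ sup|u| · |u|²` only gives `C ≤ 2C·A`). The rest is
Seregin's iteration exactly as already formalised in the tree for Seregin 2020
(`Seregin2020ScaledEnergyBounds.lean`, `Seregin2020ScaledEnergyBoundsA.lean`: the local energy
bound at cylinders touching the top `localEnergyBound_top`, after Lemarié-Rieusset 2016
p. 506 and Tsai 1998; the pressure decay estimate `seregin_sverak_pressure_decay_holds`,
Seregin–Šverák 2009 (as13); the geometric iteration `iterate_half_le`), run here for the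
functional `Ψ = A + D` with the interpolation in place of the multiplicative inequality, and —
the one new point — with all constants UNIFORM in the centre of the ball
(`uniform_bound_of_interp`), since `𝐈(Q(z, R))` is a supremum over all sub-balls: the start of
the iteration at radius `r₀ ∈ [1 - R, 2(1 - R)]` is controlled by the unit-scale data of
Def. 2.1 (`esssup_t ∫_{B(x,1)} |u|² ≤ C₀`, `∇u ∈ L²(Q(z,1))`, `p ∈ L^{3/2}(Q(z,1))`), and balls of
radius `> 1 - R` are controlled by the same data directly. The mean-free pressure quantity of
`𝐈` is dominated by the plain one (`cknDOsc_le_four_mul_cknD`, Jensen slice-wise), and the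
room to the boundary of `Q(z, 1)` for sub-balls of `Q(z, R)` is the elementary
`parabolicCylinder_subset_one_of_subset`.

## Contents (namespace `Literature.Analysis.FluidPDE.AlbrittonBarker2019`)

* geometry: `dist_add_le_of_ball_subset_ball`, `margins_of_parabolicCylinder_subset`,
  `parabolicCylinder_subset_one_of_subset`;
* `cknDOsc_le_four_mul_cknD` — `D_osc ≤ 4 D`;
* `lintegral_rate_time_le`, `cknC_le_of_rate` — the rate interpolation `C ≤ κ A^{3/4}`;
* `uniform_bound_of_interp` — Seregin's iteration with constants uniform in the centre;
* `cknAEss_le_of_energyClass` — unit-scale energy data on sub-balls;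
* `albrittonBarker2019_lemma_2_5_rate_holds` — the discharge (in the root FluidPDE namespace).

## References

* D. Albritton, T. Barker, J. Math. Fluid Mech. 21 (2019) = arXiv:1811.00502: §2, Def. 2.1,
  **Lemma 2.5** (and its proof), Lemma 2.6, Remark 3.2. [AlbrittonBarker2019]
* G. Seregin, *Estimates of suitable weak solutions to the Navier–Stokes equations in critical
  Morrey spaces*, Zap. Nauchn. Sem. POMI 336 (2006) = J. Math. Sci. 143 (2007) (the source of
  Lemma 2.6). [SereginCriticalMorrey2006]
* G. Seregin, *Lecture Notes on Regularity Theory for the Navier–Stokes Equations* (2014),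
  §6.1. [Seregin2014]
* G. Seregin, V. Šverák, Comm. PDE 34 (2009), proof of Lemma 3.5, (as13). [SereginSverak2009]
-/

noncomputable section

open MeasureTheory Set Function Filter Topology TopologicalSpace Metric
open scoped NNReal ENNReal

namespace Literature.Analysis.FluidPDE

namespace AlbrittonBarker2019

open Seregin2020

/-! ### Geometry of nested parabolic balls -/

/-- In `ℝ³`, `B(x', r) ⊆ B(x, R)` with `r > 0` forces `dist x' x + r ≤ R` (move from `x'` away
from `x` along a ray). [folklore] -/
theorem dist_add_le_of_ball_subset_ball {x' x : EuclideanSpace ℝ (Fin 3)} {r R : ℝ} (hr : 0 < r)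
    (h : ball x' r ⊆ ball x R) : dist x' x + r ≤ R := by
  -- a unit vector `e` with `‖(x' - x) + s • e‖ = ‖x' - x‖ + s` for `s ≥ 0`
  obtain ⟨e, he1, he⟩ : ∃ e : EuclideanSpace ℝ (Fin 3), ‖e‖ = 1 ∧
      ∀ s : ℝ, 0 ≤ s → ‖(x' - x) + s • e‖ = ‖x' - x‖ + s := by
    by_cases hd : x' - x = 0
    · obtain ⟨v, hv⟩ := exists_ne (0 : EuclideanSpace ℝ (Fin 3))
      refine ⟨‖v‖⁻¹ • v, ?_, fun s hs => ?_⟩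
      · rw [norm_smul, norm_inv, norm_norm, inv_mul_cancel₀ (norm_ne_zero_iff.2 hv)]
      · rw [hd, zero_add, norm_zero, zero_add, norm_smul, norm_smul, norm_inv, norm_norm,
          inv_mul_cancel₀ (norm_ne_zero_iff.2 hv), mul_one, Real.norm_of_nonneg hs]
    · refine ⟨‖x' - x‖⁻¹ • (x' - x), ?_, fun s hs => ?_⟩
      · rw [norm_smul, norm_inv, norm_norm, inv_mul_cancel₀ (norm_ne_zero_iff.2 hd)]
      · have hn : 0 < ‖x' - x‖ := norm_pos_iff.2 hd
        have : (x' - x) + s • (‖x' - x‖⁻¹ • (x' - x)) = (1 + s * ‖x' - x‖⁻¹) • (x' - x) := by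
          rw [smul_smul, add_smul, one_smul]
        rw [this, norm_smul, Real.norm_of_nonneg (by positivity), add_mul, one_mul,
          inv_mul_cancel_right₀ hn.ne']
  -- test the points `x' + (r - ε) • e`
  refine le_of_forall_pos_lt_add fun ε hε => ?_
  set s := r - min ε (r / 2) with hs
  have hs0 : 0 ≤ s := by
    have := min_le_right ε (r / 2); rw [hs]; linarith
  have hsr : s < r := by
    have : 0 < min ε (r / 2) := lt_min hε (half_pos hr); rw [hs]; linarith
  have hmem : x' + s • e ∈ ball x' r := by
    rw [mem_ball, dist_eq_norm, add_sub_cancel_left, norm_smul, he1, mul_one,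
      Real.norm_of_nonneg hs0]
    exact hsr
  have h2 := h hmem
  rw [mem_ball, dist_eq_norm, show x' + s • e - x = (x' - x) + s • e by abel, he s hs0] at h2
  rw [dist_eq_norm]
  have : min ε (r / 2) ≤ ε := min_le_left _ _
  linarith

/-- Margins of nested parabolic balls: if `Q(z', r) ⊆ Q(z, R)` with `r > 0` then `t' ≤ t`,
`t - R² ≤ t' - r²` and `dist x' x + r ≤ R` (`z = (t, x)`, `z' = (t', x')`). [folklore] -/
theorem margins_of_parabolicCylinder_subset {r R : ℝ} {z' z : ℝ × EuclideanSpace ℝ (Fin 3)}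
    (hr : 0 < r) (h : parabolicCylinder r z' ⊆ parabolicCylinder R z) :
    z'.1 ≤ z.1 ∧ z.1 - R ^ 2 ≤ z'.1 - r ^ 2 ∧ dist z'.2 z.2 + r ≤ R := by
  have hI : (Ioo (z'.1 - r ^ 2) z'.1).Nonempty := nonempty_Ioo.2 (by nlinarith)
  have hB : (ball z'.2 r).Nonempty := nonempty_ball.2 hr
  have h' : Ioo (z'.1 - r ^ 2) z'.1 ⊆ Ioo (z.1 - R ^ 2) z.1 ∧ ball z'.2 r ⊆ ball z.2 R := by
    rcases (prod_subset_prod_iff.1 h) with h1 | h1 | h1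
    · exact h1
    · exact absurd h1 hI.ne_empty
    · exact absurd h1 hB.ne_empty
  have hIoo := (Ioo_subset_Ioo_iff (by nlinarith : z'.1 - r ^ 2 < z'.1)).1 h'.1
  exact ⟨hIoo.2, hIoo.1, dist_add_le_of_ball_subset_ball hr h'.2⟩

/-- A criterion for `Q(a, ρ) ⊆ Q(z, R)` by margins (copy of the tree's
`parabolicCylinder_subset_of_margins`, kept local to lighten imports). [folklore] -/
theorem parabolicCylinder_subset_of_margins' {ρ R : ℝ} {a z : ℝ × EuclideanSpace ℝ (Fin 3)}
    (h1 : a.1 ≤ z.1) (h2 : z.1 - R ^ 2 ≤ a.1 - ρ ^ 2) (h3 : dist a.2 z.2 + ρ ≤ R) :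
    parabolicCylinder ρ a ⊆ parabolicCylinder R z := by
  intro w hw
  rw [mem_parabolicCylinder] at hw ⊢
  refine ⟨⟨by linarith [hw.1.1], lt_of_lt_of_le hw.1.2 h1⟩, ?_⟩
  calc dist w.2 z.2 ≤ dist w.2 a.2 + dist a.2 z.2 := dist_triangle _ _ _
    _ < ρ + dist a.2 z.2 := by linarith [hw.2]
    _ ≤ R := by linarith

/-- **Room to the boundary.** If `Q(z', r) ⊆ Q(z, R)` with `0 < r` and `R ≤ 1`, then every
ball `Q(z', ρ)` with `0 < ρ ≤ r + (1 - R)` about the same centre lies in the unit ball `Q(z, 1)`.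
[folklore] -/
theorem parabolicCylinder_subset_one_of_subset {r R ρ : ℝ} {z' z : ℝ × EuclideanSpace ℝ (Fin 3)}
    (hr : 0 < r) (hR : R ≤ 1) (h : parabolicCylinder r z' ⊆ parabolicCylinder R z) (hρ0 : 0 < ρ)
    (hρ : ρ ≤ r + (1 - R)) :
    parabolicCylinder ρ z' ⊆ parabolicCylinder 1 z := by
  obtain ⟨h1, h2, h3⟩ := margins_of_parabolicCylinder_subset hr h
  have hd : 0 ≤ dist z'.2 z.2 := dist_nonneg
  refine parabolicCylinder_subset_of_margins' h1 ?_ ?_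
  · nlinarith
  · linarith

/-- If `Q(z', r) ⊆ Q(z, R)` with `r > 0` then `r ≤ R`. [folklore] -/
theorem radius_le_of_parabolicCylinder_subset {r R : ℝ} {z' z : ℝ × EuclideanSpace ℝ (Fin 3)}
    (hr : 0 < r) (h : parabolicCylinder r z' ⊆ parabolicCylinder R z) : r ≤ R := by
  have := (margins_of_parabolicCylinder_subset hr h).2.2
  linarith [dist_nonneg (x := z'.2) (y := z.2)]

/-! ### The mean-free pressure quantity is dominated by the plain one -/

/-- `D_osc ≤ 4 D`: subtracting the spatial mean costs at most a factor `4` in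
`r⁻² ∫_{Q(z,r)} |·|^{3/2}` (`|q - [q]|^{3/2} ≤ √2 (|q|^{3/2} + |[q]|^{3/2})` and Jensen
`∫ |[q]_B|^{3/2} ≤ ∫ |q|^{3/2}` slice-wise). [folklore] -/
theorem cknDOsc_le_four_mul_cknD {r : ℝ} (hr : 0 < r) {z : ℝ × EuclideanSpace ℝ (Fin 3)}
    {q : ℝ → EuclideanSpace ℝ (Fin 3) → ℝ}
    (hq : AEStronglyMeasurable (uncurry q) (volume.restrict (parabolicCylinder r z))) :
    cknDOsc r z q ≤ 4 * cknD r z q := by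
  rw [cknDOsc, cknD, mul_left_comm]
  gcongr
  set I : Set ℝ := Ioo (z.1 - r ^ 2) z.1 with hI
  set B : Set (EuclideanSpace ℝ (Fin 3)) := ball z.2 r with hB
  have hQ : parabolicCylinder r z = I ×ˢ B := rfl
  rw [hQ] at hq ⊢
  have hB0 : volume B ≠ 0 := (measure_ball_pos volume z.2 hr).ne'
  have hBtop : volume B ≠ ∞ := measure_ball_lt_top.ne
  -- pointwise splitting
  have hpt : ∀ w : ℝ × EuclideanSpace ℝ (Fin 3),
      ‖q w.1 w.2 - ⨍ y in B, q w.1 y‖ₑ ^ (3 / 2 : ℝ) ≤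
        2 * ‖q w.1 w.2‖ₑ ^ (3 / 2 : ℝ) + 2 * ‖⨍ y in B, q w.1 y‖ₑ ^ (3 / 2 : ℝ) := by
    intro w
    calc ‖q w.1 w.2 - ⨍ y in B, q w.1 y‖ₑ ^ (3 / 2 : ℝ)
        ≤ (‖q w.1 w.2‖ₑ + ‖⨍ y in B, q w.1 y‖ₑ) ^ (3 / 2 : ℝ) := by
          gcongr; exact enorm_sub_le
      _ ≤ 2 ^ ((3 / 2 : ℝ) - 1) * (‖q w.1 w.2‖ₑ ^ (3 / 2 : ℝ) + ‖⨍ y in B, q w.1 y‖ₑ ^ (3 / 2 : ℝ)) :=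
          ENNReal.rpow_add_le_mul_rpow_add_rpow _ _ (by norm_num)
      _ ≤ 2 * (‖q w.1 w.2‖ₑ ^ (3 / 2 : ℝ) + ‖⨍ y in B, q w.1 y‖ₑ ^ (3 / 2 : ℝ)) := by
          gcongr
          calc (2 : ℝ≥0∞) ^ ((3 / 2 : ℝ) - 1) ≤ 2 ^ (1 : ℝ) :=
                ENNReal.rpow_le_rpow_of_exponent_le (by norm_num) (by norm_num)
            _ = 2 := ENNReal.rpow_one _
      _ = _ := by ring
  have hf : AEMeasurable (fun w : ℝ × EuclideanSpace ℝ (Fin 3) => 2 * ‖q w.1 w.2‖ₑ ^ (3 / 2 : ℝ))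
      (volume.restrict (I ×ˢ B)) :=
    (hq.aemeasurable.enorm.pow_const _).const_mul _
  calc ∫⁻ w in I ×ˢ B, ‖q w.1 w.2 - ⨍ y in B, q w.1 y‖ₑ ^ (3 / 2 : ℝ)
      ≤ ∫⁻ w in I ×ˢ B, (2 * ‖q w.1 w.2‖ₑ ^ (3 / 2 : ℝ) + 2 * ‖⨍ y in B, q w.1 y‖ₑ ^ (3 / 2 : ℝ)) :=
        lintegral_mono fun w => hpt w
    _ = 2 * (∫⁻ w in I ×ˢ B, ‖q w.1 w.2‖ₑ ^ (3 / 2 : ℝ)) +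
          2 * (∫⁻ w in I ×ˢ B, ‖⨍ y in B, q w.1 y‖ₑ ^ (3 / 2 : ℝ)) := by
        rw [lintegral_add_left' hf, lintegral_const_mul' _ _ ENNReal.ofNat_ne_top,
          lintegral_const_mul' _ _ ENNReal.ofNat_ne_top]
    _ ≤ 2 * (∫⁻ w in I ×ˢ B, ‖q w.1 w.2‖ₑ ^ (3 / 2 : ℝ)) +
          2 * (∫⁻ w in I ×ˢ B, ‖q w.1 w.2‖ₑ ^ (3 / 2 : ℝ)) := by
        gcongr _ + 2 * ?_
        exact lintegral_enorm_setAverage_slice_rpow_le hB0 hBtop (by norm_num) hq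
    _ = 4 * ∫⁻ w in I ×ˢ B, ‖q w.1 w.2‖ₑ ^ (3 / 2 : ℝ) := by
        rw [← two_mul, ← mul_assoc]; norm_num

/-! ### The time integral of the rate -/

/-- `∫_{t'-ρ²}^{t'} (t - s)^{-3/4} ds ≤ 4 ρ^{1/2}` for `t' ≤ t`, `ρ > 0` (the worst case is
`t' = t`; subadditivity of `x ↦ x^{1/4}`). [folklore] -/
theorem lintegral_rate_time_le {t t' ρ : ℝ} (ht : t' ≤ t) (hρ : 0 < ρ) :
    ∫⁻ s in Ioo (t' - ρ ^ 2) t', ENNReal.ofReal ((t - s) ^ (-(3 / 4) : ℝ)) ≤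
      ENNReal.ofReal (4 * ρ ^ (1 / 2 : ℝ)) := by
  have hab : t' - ρ ^ 2 ≤ t' := by nlinarith
  -- integrability of the (possibly improper) power
  have hint : IntegrableOn (fun s => (t - s) ^ (-(3 / 4) : ℝ)) (Ioo (t' - ρ ^ 2) t') volume := by
    have h1 : IntervalIntegrable (fun x : ℝ => x ^ (-(3 / 4) : ℝ)) volume (t - (t' - ρ ^ 2)) (t - t') :=
      intervalIntegral.intervalIntegrable_rpow' (by norm_num)
    have h2 := h1.comp_sub_left t
    simp only [sub_sub_cancel] at h2
    exact ((intervalIntegrable_iff_integrableOn_Ioc_of_le hab).1 h2).mono_set Ioo_subset_Ioc_self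
  have hnn : 0 ≤ᵐ[volume.restrict (Ioo (t' - ρ ^ 2) t')] fun s => (t - s) ^ (-(3 / 4) : ℝ) := by
    filter_upwards [ae_restrict_mem measurableSet_Ioo] with s hs
    exact Real.rpow_nonneg (by linarith [hs.2]) _
  rw [← ofReal_integral_eq_lintegral_ofReal hint hnn]
  refine ENNReal.ofReal_le_ofReal ?_
  -- evaluate the integral
  have heval : ∫ s in Ioo (t' - ρ ^ 2) t', (t - s) ^ (-(3 / 4) : ℝ) =
      ((t - t' + ρ ^ 2) ^ (1 / 4 : ℝ) - (t - t') ^ (1 / 4 : ℝ)) / (1 / 4 : ℝ) := by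
    rw [← integral_Ioc_eq_integral_Ioo, ← intervalIntegral.integral_of_le hab,
      intervalIntegral.integral_comp_sub_left (fun x : ℝ => x ^ (-(3 / 4) : ℝ)) t,
      integral_rpow (Or.inl (by norm_num))]
    congr 1
    · rw [show t - (t' - ρ ^ 2) = t - t' + ρ ^ 2 by ring]; norm_num
    · norm_num
  rw [heval]
  have hα : 0 ≤ t - t' := by linarith
  have hsub : (t - t' + ρ ^ 2) ^ (1 / 4 : ℝ) ≤ (t - t') ^ (1 / 4 : ℝ) + (ρ ^ 2) ^ (1 / 4 : ℝ) :=
    Real.rpow_add_le_add_rpow hα (by positivity) (by norm_num) (by norm_num)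
  have hρ2 : (ρ ^ 2) ^ (1 / 4 : ℝ) = ρ ^ (1 / 2 : ℝ) := by
    rw [show ρ ^ 2 = ρ ^ (2 : ℝ) by norm_cast, ← Real.rpow_mul hρ.le]; norm_num
  rw [div_eq_mul_inv, show ((1 : ℝ) / 4)⁻¹ = 4 by norm_num]
  nlinarith [hsub, hρ2, Real.rpow_nonneg hρ.le (1 / 2 : ℝ)]

/-! ### The rate interpolation `C ≤ κ A^{3/4}` -/

/-- Bookkeeping of the powers of the radius in the rate interpolation:
`ρ⁻² · ρ^{1/2} · ρ^{3/4} · (ρ³)^{1/4} = 1`. [folklore] -/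
theorem radius_powers_eq_one {ρ : ℝ} (hρ : 0 < ρ) :
    (ENNReal.ofReal ρ ^ 2)⁻¹ * ENNReal.ofReal (ρ ^ (1 / 2 : ℝ)) *
      (ENNReal.ofReal ρ ^ (3 / 4 : ℝ) * ENNReal.ofReal (ρ ^ 3) ^ (1 / 4 : ℝ)) = 1 := by
  rw [ENNReal.ofReal_rpow_of_pos hρ, ENNReal.ofReal_rpow_of_pos (by positivity),
    ← ENNReal.ofReal_pow hρ.le, ← ENNReal.ofReal_inv_of_pos (by positivity),
    ← ENNReal.ofReal_mul (by positivity), ← ENNReal.ofReal_mul (by positivity),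
    ← ENNReal.ofReal_mul (by positivity), ← ENNReal.ofReal_one]
  congr 1
  have h3 : (ρ ^ 3) ^ (1 / 4 : ℝ) = ρ ^ (3 / 4 : ℝ) := by
    rw [show ρ ^ 3 = ρ ^ (3 : ℝ) by norm_cast, ← Real.rpow_mul hρ.le]; norm_num
  have h2 : ρ ^ (1 / 2 : ℝ) * (ρ ^ (3 / 4 : ℝ) * ρ ^ (3 / 4 : ℝ)) = ρ ^ 2 := by
    rw [← Real.rpow_add hρ, ← Real.rpow_add hρ, show ρ ^ 2 = ρ ^ (2 : ℝ) by norm_cast]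
    norm_num
  rw [h3, mul_assoc, h2, inv_mul_cancel₀ (by positivity)]

/-- The rate `C/√(t-s)` to the power `3/2`: `(C/√(t-s))^{3/2} = C^{3/2} (t-s)^{-3/4}` for
`s < t`, `C ≥ 0`, in `ℝ≥0∞`. [folklore] -/
theorem ofReal_rate_rpow {C t s : ℝ} (hC : 0 ≤ C) (hs : s < t) :
    ENNReal.ofReal (C / Real.sqrt (t - s)) ^ (3 / 2 : ℝ) =
      ENNReal.ofReal (C ^ (3 / 2 : ℝ)) * ENNReal.ofReal ((t - s) ^ (-(3 / 4) : ℝ)) := by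
  have hts : 0 < t - s := by linarith
  rw [ENNReal.ofReal_rpow_of_nonneg (by positivity) (by norm_num),
    ← ENNReal.ofReal_mul (by positivity)]
  congr 1
  rw [Real.div_rpow hC (Real.sqrt_nonneg _), Real.sqrt_eq_rpow, ← Real.rpow_mul hts.le,
    div_eq_mul_inv, ← Real.rpow_neg hts.le]
  norm_num

/-- **The rate interpolation** (the step replacing Albritton–Barker's Lorentz/Morrey bound of
Lemma 2.5 in the pointwise-rate case): if `|u(s, y)| ≤ C/√(t - s)` on `Q(z, 1)`, `z = (t, x)`,
then on every parabolic sub-ball `Q(z', ρ) ⊆ Q(z, 1)`,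
`C(Q(z', ρ)) ≤ 4 |B₁|^{1/4} C^{3/2} · A(Q(z', ρ))^{3/4}`: slice-wise
`∫_B |u|³ ≤ sup|u|^{3/2} |B|^{1/4} (∫_B |u|²)^{3/4}` (Hölder), then
`∫_{t'-ρ²}^{t'} (t-s)^{-3/4} ds ≤ 4ρ^{1/2}`. [cite: AlbrittonBarker2019, proof of Lemma 2.5 (arXiv:1811.00502 §2), rate case] -/
theorem cknC_le_of_rate {z : ℝ × EuclideanSpace ℝ (Fin 3)}
    {u : ℝ → EuclideanSpace ℝ (Fin 3) → EuclideanSpace ℝ (Fin 3)} {C : ℝ} (hC : 0 ≤ C)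
    (hu : AEStronglyMeasurable (uncurry u) (volume.restrict (parabolicCylinder 1 z)))
    (hrate : ∀ s y, (s, y) ∈ parabolicCylinder 1 z → ‖u s y‖ ≤ C / Real.sqrt (z.1 - s))
    {z' : ℝ × EuclideanSpace ℝ (Fin 3)} {ρ : ℝ} (hρ : 0 < ρ)
    (hsub : parabolicCylinder ρ z' ⊆ parabolicCylinder 1 z) :
    cknC ρ z' u ≤ (4 * volume (ball (0 : EuclideanSpace ℝ (Fin 3)) 1) ^ (1 / 4 : ℝ) *
        ENNReal.ofReal (C ^ (3 / 2 : ℝ))) * cknAEss ρ z' u ^ (3 / 4 : ℝ) := by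
  -- notation
  set I : Set ℝ := Ioo (z'.1 - ρ ^ 2) z'.1 with hI
  set B : Set (EuclideanSpace ℝ (Fin 3)) := ball z'.2 ρ with hB
  set A := cknAEss ρ z' u with hA
  set V₁ : ℝ≥0∞ := volume (ball (0 : EuclideanSpace ℝ (Fin 3)) 1) with hV₁
  have hQ : parabolicCylinder ρ z' = I ×ˢ B := rfl
  have ht' : z'.1 ≤ z.1 := (margins_of_parabolicCylinder_subset hρ hsub).1
  have hρ0 : ENNReal.ofReal ρ ≠ 0 := (ENNReal.ofReal_pos.2 hρ).ne'
  have hvolB : volume B = ENNReal.ofReal (ρ ^ 3) * V₁ := by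
    rw [hB, Measure.addHaar_ball_of_pos volume z'.2 hρ, finrank_euclideanSpace_fin]
  -- measurability on the sub-ball
  have hu' : AEStronglyMeasurable (uncurry u) ((volume.restrict I).prod (volume.restrict B)) := by
    rw [← volume_restrict_prod_eq, ← hQ]
    exact hu.mono_measure (Measure.restrict_mono hsub le_rfl)
  have hum3 : AEMeasurable (fun q : ℝ × EuclideanSpace ℝ (Fin 3) => ‖u q.1 q.2‖ₑ ^ (3 : ℕ))
      ((volume.restrict I).prod (volume.restrict B)) := hu'.aemeasurable.enorm.pow_const _
  -- Tonelli
  have hCeq : cknC ρ z' u = (ENNReal.ofReal ρ ^ 2)⁻¹ * ∫⁻ s in I, ∫⁻ y in B, ‖u s y‖ₑ ^ (3 : ℕ) := by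
    rw [cknC, hQ, Measure.volume_eq_prod, setLIntegral_prod _ (by rwa [← Measure.prod_restrict])]
  -- the energy bound and slice measurability, a.e. in time
  have h1 : ∀ᵐ s ∂(volume.restrict I), (ENNReal.ofReal ρ)⁻¹ * ∫⁻ y in B, ‖u s y‖ₑ ^ 2 ≤ A := by
    rw [hA, cknAEss]
    exact ENNReal.ae_le_essSup _
  have h2 : ∀ᵐ s ∂(volume.restrict I), AEStronglyMeasurable (fun y => u s y) (volume.restrict B) :=
    hu'.prodMk_left
  have h3 : ∀ᵐ s ∂(volume.restrict I), s ∈ I := ae_restrict_mem measurableSet_Ioo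
  -- ### the slice estimate
  have hpq : (4 / 3 : ℝ).HolderConjugate 4 := Real.holderConjugate_iff.2 ⟨by norm_num, by norm_num⟩
  set K : ℝ≥0∞ := ENNReal.ofReal (C ^ (3 / 2 : ℝ)) *
    ((ENNReal.ofReal ρ * A) ^ (3 / 4 : ℝ) * (volume B) ^ (1 / 4 : ℝ)) with hK
  have slice : ∀ᵐ s ∂(volume.restrict I),
      ∫⁻ y in B, ‖u s y‖ₑ ^ (3 : ℕ) ≤ ENNReal.ofReal ((z.1 - s) ^ (-(3 / 4) : ℝ)) * K := by
    filter_upwards [h1, h2, h3] with s hs1 hs2 hs3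
    have hst : s < z.1 := lt_of_lt_of_le hs3.2 ht'
    set M : ℝ≥0∞ := ENNReal.ofReal (C / Real.sqrt (z.1 - s)) with hM
    have hM32 : M ^ (3 / 2 : ℝ) ≠ ∞ := ENNReal.rpow_ne_top_of_nonneg (by norm_num) ENNReal.ofReal_ne_top
    -- pointwise: `|u|³ ≤ M^{3/2} |u|^{3/2}` on the ball
    have hpt : ∀ᵐ y ∂(volume.restrict B), ‖u s y‖ₑ ^ (3 : ℕ) ≤ M ^ (3 / 2 : ℝ) * ‖u s y‖ₑ ^ (3 / 2 : ℝ) := by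
      filter_upwards [ae_restrict_mem measurableSet_ball] with y hy
      have hmem : (s, y) ∈ parabolicCylinder 1 z := hsub (by rw [hQ]; exact ⟨hs3, hy⟩)
      have hle : ‖u s y‖ₑ ≤ M := by
        rw [hM, ← ofReal_norm]
        exact ENNReal.ofReal_le_ofReal (hrate s y hmem)
      calc ‖u s y‖ₑ ^ (3 : ℕ) = ‖u s y‖ₑ ^ (3 / 2 : ℝ) * ‖u s y‖ₑ ^ (3 / 2 : ℝ) := by
            rw [← ENNReal.rpow_add_of_nonneg _ _ (by norm_num) (by norm_num),
              ← ENNReal.rpow_natCast]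
            norm_num
        _ ≤ M ^ (3 / 2 : ℝ) * ‖u s y‖ₑ ^ (3 / 2 : ℝ) := by gcongr
    -- Hölder with exponents `4/3`, `4`
    have hf : AEMeasurable (fun y => ‖u s y‖ₑ ^ (3 / 2 : ℝ)) (volume.restrict B) :=
      hs2.aemeasurable.enorm.pow_const _
    have hHolder : ∫⁻ y in B, ‖u s y‖ₑ ^ (3 / 2 : ℝ) ≤
        (∫⁻ y in B, ‖u s y‖ₑ ^ 2) ^ (3 / 4 : ℝ) * (volume B) ^ (1 / 4 : ℝ) := by
      have key := ENNReal.lintegral_mul_le_Lp_mul_Lq (volume.restrict B) hpq hf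
        (g := fun _ => (1 : ℝ≥0∞)) aemeasurable_const
      simp only [Pi.mul_apply, mul_one, ENNReal.one_rpow, lintegral_const,
        Measure.restrict_apply_univ, one_mul] at key
      have e1 : ∀ y, (‖u s y‖ₑ ^ (3 / 2 : ℝ)) ^ (4 / 3 : ℝ) = ‖u s y‖ₑ ^ 2 := fun y => by
        rw [← ENNReal.rpow_mul, show (3 / 2 : ℝ) * (4 / 3) = (2 : ℕ) by norm_num,
          ENNReal.rpow_natCast]
      simp only [e1] at key
      convert key using 2; norm_num
    -- the energy bound
    have hen : ∫⁻ y in B, ‖u s y‖ₑ ^ 2 ≤ ENNReal.ofReal ρ * A := by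
      calc ∫⁻ y in B, ‖u s y‖ₑ ^ 2
          = ENNReal.ofReal ρ * ((ENNReal.ofReal ρ)⁻¹ * ∫⁻ y in B, ‖u s y‖ₑ ^ 2) := by
            rw [← mul_assoc, ENNReal.mul_inv_cancel hρ0 ENNReal.ofReal_ne_top, one_mul]
        _ ≤ ENNReal.ofReal ρ * A := by gcongr
    -- combine
    calc ∫⁻ y in B, ‖u s y‖ₑ ^ (3 : ℕ)
        ≤ ∫⁻ y in B, M ^ (3 / 2 : ℝ) * ‖u s y‖ₑ ^ (3 / 2 : ℝ) := lintegral_mono_ae hpt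
      _ = M ^ (3 / 2 : ℝ) * ∫⁻ y in B, ‖u s y‖ₑ ^ (3 / 2 : ℝ) := lintegral_const_mul' _ _ hM32
      _ ≤ M ^ (3 / 2 : ℝ) * ((∫⁻ y in B, ‖u s y‖ₑ ^ 2) ^ (3 / 4 : ℝ) * (volume B) ^ (1 / 4 : ℝ)) := by
          gcongr
      _ ≤ M ^ (3 / 2 : ℝ) * ((ENNReal.ofReal ρ * A) ^ (3 / 4 : ℝ) * (volume B) ^ (1 / 4 : ℝ)) := by
          gcongr
      _ = ENNReal.ofReal ((z.1 - s) ^ (-(3 / 4) : ℝ)) * K := by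
          rw [hM, ofReal_rate_rpow hC hst, hK]; ring
  -- ### integrate the slice estimate in time
  have hFm : Measurable fun s : ℝ => ENNReal.ofReal ((z.1 - s) ^ (-(3 / 4) : ℝ)) :=
    ENNReal.measurable_ofReal.comp ((measurable_const.sub measurable_id).pow_const _)
  have htime := lintegral_rate_time_le (t := z.1) ht' hρ
  calc cknC ρ z' u = (ENNReal.ofReal ρ ^ 2)⁻¹ * ∫⁻ s in I, ∫⁻ y in B, ‖u s y‖ₑ ^ (3 : ℕ) := hCeq
    _ ≤ (ENNReal.ofReal ρ ^ 2)⁻¹ * ∫⁻ s in I, ENNReal.ofReal ((z.1 - s) ^ (-(3 / 4) : ℝ)) * K :=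
        mul_le_mul' le_rfl (lintegral_mono_ae slice)
    _ = (ENNReal.ofReal ρ ^ 2)⁻¹ * ((∫⁻ s in I, ENNReal.ofReal ((z.1 - s) ^ (-(3 / 4) : ℝ))) * K) := by
        rw [lintegral_mul_const _ hFm]
    _ ≤ (ENNReal.ofReal ρ ^ 2)⁻¹ * (ENNReal.ofReal (4 * ρ ^ (1 / 2 : ℝ)) * K) := by gcongr
    _ = (4 * V₁ ^ (1 / 4 : ℝ) * ENNReal.ofReal (C ^ (3 / 2 : ℝ))) * A ^ (3 / 4 : ℝ) := by
        rw [hK, hvolB, ENNReal.ofReal_mul (by norm_num : (0 : ℝ) ≤ 4), ENNReal.ofReal_ofNat,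
          ENNReal.mul_rpow_of_nonneg _ _ (by norm_num : (0 : ℝ) ≤ 3 / 4),
          ENNReal.mul_rpow_of_nonneg _ _ (by norm_num : (0 : ℝ) ≤ 1 / 4)]
        calc (ENNReal.ofReal ρ ^ 2)⁻¹ * (4 * ENNReal.ofReal (ρ ^ (1 / 2 : ℝ)) *
              (ENNReal.ofReal (C ^ (3 / 2 : ℝ)) * (ENNReal.ofReal ρ ^ (3 / 4 : ℝ) * A ^ (3 / 4 : ℝ) *
                (ENNReal.ofReal (ρ ^ 3) ^ (1 / 4 : ℝ) * V₁ ^ (1 / 4 : ℝ)))))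
            = ((ENNReal.ofReal ρ ^ 2)⁻¹ * ENNReal.ofReal (ρ ^ (1 / 2 : ℝ)) *
                (ENNReal.ofReal ρ ^ (3 / 4 : ℝ) * ENNReal.ofReal (ρ ^ 3) ^ (1 / 4 : ℝ))) *
              ((4 * V₁ ^ (1 / 4 : ℝ) * ENNReal.ofReal (C ^ (3 / 2 : ℝ))) * A ^ (3 / 4 : ℝ)) := by ring
          _ = _ := by rw [radius_powers_eq_one hρ, one_mul]

/-! ### Seregin's iteration with the rate interpolation, constants uniform in the centre -/

/-- **Uniform scaled bounds from the rate interpolation** (Seregin 2006/2007, the Morrey case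
of Albritton–Barker 2019, Lemma 2.6, specialised to the interpolation `C ≤ κ A^{3/4}`). Let
`(u, p)` be a suitable weak solution of the unforced Navier–Stokes equations (`ν = 1`) on an
open `Q ⊆ ℝ × ℝ³`, `G` a weak spatial gradient of `u` on `Q`, and suppose
`C(Q') ≤ κ A(Q')^{3/4}` for every parabolic ball `Q' ⊆ Q`, `κ < ∞`. Then for all finite levels
`A₀, D₀` there is `K < ∞` such that for EVERY ball `Q(z', r₀) ⊆ Q` with `A(r₀; z') ≤ A₀` and
`D(r₀; z') ≤ D₀`, `A + E + C + D ≤ K` on all `Q(z', ρ)`, `0 < ρ ≤ r₀/2`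
(`A = cknAEss`, `E = cknE`, `C = cknC`, `D = cknD`). Proof: the functional `Ψ = A + D`
satisfies `Ψ(θR) ≤ Ψ(R)/2 + b` (local energy bound at the top, pressure decay, Young), is
iterated along `θᵏ r₀`, monotonicity fills the radii, and the case of a bounded `C`
(pressure decay iterated, local energy bound) concludes — with every constant depending only on
`κ, A₀, D₀`. [cite: AlbrittonBarker2019, Lemma 2.6 and proof of Lemma 2.5 (arXiv:1811.00502 §2); Seregin2014 §6.1] -/
theorem uniform_bound_of_interp {Q : Opens (ℝ × EuclideanSpace ℝ (Fin 3))}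
    {u : ℝ → EuclideanSpace ℝ (Fin 3) → EuclideanSpace ℝ (Fin 3)}
    {p : ℝ → EuclideanSpace ℝ (Fin 3) → ℝ}
    {G : ℝ → EuclideanSpace ℝ (Fin 3) → EuclideanSpace ℝ (Fin 3) →L[ℝ] EuclideanSpace ℝ (Fin 3)}
    (hsw : IsSuitableWeakSolutionOn Q 1 0 u p)
    (hG : HasWeakSpatialGradientOn Q u G) {κ : ℝ≥0∞} (hκ : κ ≠ ∞)
    (hinterp : ∀ (z' : ℝ × EuclideanSpace ℝ (Fin 3)) (ρ : ℝ), 0 < ρ →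
      parabolicCylinder ρ z' ⊆ (Q : Set (ℝ × EuclideanSpace ℝ (Fin 3))) →
      cknC ρ z' u ≤ κ * cknAEss ρ z' u ^ (3 / 4 : ℝ))
    {A₀ D₀ : ℝ≥0∞} (hA₀ : A₀ ≠ ∞) (hD₀ : D₀ ≠ ∞) :
    ∃ K : ℝ≥0∞, K ≠ ∞ ∧ ∀ (z' : ℝ × EuclideanSpace ℝ (Fin 3)) (r₀ : ℝ), 0 < r₀ →
      parabolicCylinder r₀ z' ⊆ (Q : Set (ℝ × EuclideanSpace ℝ (Fin 3))) →
      cknAEss r₀ z' u ≤ A₀ → cknD r₀ z' p ≤ D₀ →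
      ∀ ρ ∈ Ioc (0 : ℝ) (r₀ / 2),
        cknAEss ρ z' u + cknE ρ z' G + cknC ρ z' u + cknD ρ z' p ≤ K := by
  -- ### the constants of the three estimates
  obtain ⟨c, hc⟩ := seregin_sverak_pressure_decay_holds.ratio
  obtain ⟨c₁, c₂, c₃, HT⟩ := localEnergyBound_top
  -- `θ` with `c θ ≤ 1/4` and `θ ≤ 1/2`
  obtain ⟨θ, hθ, hθhalf, hcθ2⟩ := exists_ratio_mul_le_half (2 * c)
  have hθ1 : θ ≤ 1 := hθhalf.trans (by norm_num)
  have hcθ : (c : ℝ≥0∞) * ENNReal.ofReal θ ≤ 2⁻¹ * 2⁻¹ := by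
    calc (c : ℝ≥0∞) * ENNReal.ofReal θ = 2⁻¹ * (((2 * c : ℝ≥0) : ℝ≥0∞) * ENNReal.ofReal θ) := by
          push_cast
          rw [← mul_assoc, ← mul_assoc, ENNReal.inv_mul_cancel two_ne_zero ENNReal.ofNat_ne_top,
            one_mul]
      _ ≤ 2⁻¹ * 2⁻¹ := by gcongr
  -- the Young parameter `s` with `(2θ)⁻¹ c₃ s ≤ 1/4`
  set L : ℝ≥0∞ := ENNReal.ofReal ((2 * θ)⁻¹) * c₃ with hL
  have hLtop : L ≠ ∞ := ENNReal.mul_ne_top ENNReal.ofReal_ne_top ENNReal.coe_ne_top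
  set s : ℝ≥0∞ := 2⁻¹ * 2⁻¹ * (L + 1)⁻¹ with hs
  have h2i0 : (2⁻¹ : ℝ≥0∞) ≠ 0 := ENNReal.inv_ne_zero.2 ENNReal.ofNat_ne_top
  have h2it : (2⁻¹ : ℝ≥0∞) ≠ ∞ := ENNReal.inv_ne_top.2 two_ne_zero
  have hs0 : s ≠ 0 := mul_ne_zero (mul_ne_zero h2i0 h2i0)
    (ENNReal.inv_ne_zero.2 (ENNReal.add_ne_top.2 ⟨hLtop, ENNReal.one_ne_top⟩))
  have hstop : s ≠ ∞ := ENNReal.mul_ne_top (ENNReal.mul_ne_top h2it h2it)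
    (ENNReal.inv_ne_top.2 (by simp))
  have hLs : L * s ≤ 2⁻¹ * 2⁻¹ := by
    have h1 : L * (L + 1)⁻¹ ≤ 1 := by
      rw [← div_eq_mul_inv]
      exact ENNReal.div_le_of_le_mul (by rw [one_mul]; exact le_self_add)
    calc L * s = 2⁻¹ * 2⁻¹ * (L * (L + 1)⁻¹) := by rw [hs]; ring
      _ ≤ 2⁻¹ * 2⁻¹ * 1 := by gcongr
      _ = 2⁻¹ * 2⁻¹ := mul_one _
  -- coefficients of `A^{1/2}` and `A^{3/4}`, and the absorption constants
  set α₁ : ℝ≥0∞ := ENNReal.ofReal ((2 * θ)⁻¹) * c₁ * κ ^ (2 / 3 : ℝ) with hα₁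
  set α₂ : ℝ≥0∞ := (ENNReal.ofReal ((2 * θ)⁻¹) * (c₂ + c₃ * s⁻¹ ^ 2) +
    c * ENNReal.ofReal (θ⁻¹ ^ 2)) * κ with hα₂
  have hsi : s⁻¹ ≠ ∞ := ENNReal.inv_ne_top.2 hs0
  have hα₁top : α₁ ≠ ∞ := ENNReal.mul_ne_top
    (ENNReal.mul_ne_top ENNReal.ofReal_ne_top ENNReal.coe_ne_top)
    (ENNReal.rpow_ne_top_of_nonneg (by norm_num) hκ)
  have hα₂top : α₂ ≠ ∞ := by
    refine ENNReal.mul_ne_top (ENNReal.add_ne_top.2 ⟨?_, ?_⟩) hκ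
    · exact ENNReal.mul_ne_top ENNReal.ofReal_ne_top (ENNReal.add_ne_top.2 ⟨ENNReal.coe_ne_top,
        ENNReal.mul_ne_top ENNReal.coe_ne_top (ENNReal.pow_ne_top hsi)⟩)
    · exact ENNReal.mul_ne_top ENNReal.coe_ne_top ENNReal.ofReal_ne_top
  set ε : ℝ≥0∞ := 2⁻¹ * 2⁻¹ with hε
  have hε0 : ε ≠ 0 := mul_ne_zero h2i0 h2i0
  have hεtop : ε ≠ ∞ := ENNReal.mul_ne_top h2it h2it
  have hεi : ε⁻¹ ≠ ∞ := ENNReal.inv_ne_top.2 hε0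
  set K₁ : ℝ≥0∞ := (α₁ * ε⁻¹ ^ (1 / 2 : ℝ)) ^ (1 / (1 - 1 / 2 : ℝ)) with hK₁
  set K₂ : ℝ≥0∞ := (α₂ * ε⁻¹ ^ (3 / 4 : ℝ)) ^ (1 / (1 - 3 / 4 : ℝ)) with hK₂
  have hK₁top : K₁ ≠ ∞ := ENNReal.rpow_ne_top_of_nonneg (by norm_num)
    (ENNReal.mul_ne_top hα₁top (ENNReal.rpow_ne_top_of_nonneg (by norm_num) hεi))
  have hK₂top : K₂ ≠ ∞ := ENNReal.rpow_ne_top_of_nonneg (by norm_num)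
    (ENNReal.mul_ne_top hα₂top (ENNReal.rpow_ne_top_of_nonneg (by norm_num) hεi))
  set b : ℝ≥0∞ := K₁ + K₂ with hb
  have hbtop : b ≠ ∞ := ENNReal.add_ne_top.2 ⟨hK₁top, hK₂top⟩
  -- ### the one-step inequality for `Ψ = A + D`, uniformly in the centre
  have step : ∀ (z' : ℝ × EuclideanSpace ℝ (Fin 3)) (R : ℝ), 0 < R →
      parabolicCylinder R z' ⊆ (Q : Set (ℝ × EuclideanSpace ℝ (Fin 3))) →
      cknAEss (θ * R) z' u + cknD (θ * R) z' p ≤ (cknAEss R z' u + cknD R z' p) / 2 + b := by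
    intro z' R hR0 hQR
    set AA := cknAEss R z' u with hAA
    set D := cknD R z' p with hDdef
    set C := cknC R z' u with hCdef
    -- the energy at `θR` through `R/2`
    have hA1 : cknAEss (θ * R) z' u ≤ ENNReal.ofReal ((2 * θ)⁻¹) *
        (c₁ * C ^ (2 / 3 : ℝ) + c₂ * C + c₃ * (D ^ (2 / 3 : ℝ) * C ^ (1 / 3 : ℝ))) := by
      have hθR : θ * R ≤ R / 2 := by nlinarith
      have hI : Ioo (z'.1 - (θ * R) ^ 2) z'.1 ⊆ Ioo (z'.1 - (R / 2) ^ 2) z'.1 :=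
        Ioo_subset_Ioo (by nlinarith [pow_le_pow_left₀ (mul_pos hθ hR0).le hθR 2]) le_rfl
      have hB : ball z'.2 (θ * R) ⊆ ball z'.2 (R / 2) := ball_subset_ball hθR
      have hmono := cknAEss_le_mul_of_subset (half_pos hR0) (mul_pos hθ hR0) hI hB u
      have e1 : R / 2 / (θ * R) = (2 * θ)⁻¹ := by field_simp
      rw [e1] at hmono
      have hT := HT Q u p G hsw hG z' R hR0 hQR
      calc cknAEss (θ * R) z' u ≤ ENNReal.ofReal ((2 * θ)⁻¹) * cknAEss (R / 2) z' u := hmono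
        _ ≤ ENNReal.ofReal ((2 * θ)⁻¹) * (cknAEss (R / 2) z' u + cknE (R / 2) z' G) := by
            gcongr; exact le_self_add
        _ ≤ _ := by gcongr
    -- the pressure at `θR`
    have hD1 : cknD (θ * R) z' p ≤
        c * (ENNReal.ofReal θ * D + ENNReal.ofReal ((θ⁻¹) ^ 2) * C) :=
      hc Q u p hsw.distributional z' R θ hR0 hθ hθ1 hQR
    -- Young for the mixed term
    have hY : D ^ (2 / 3 : ℝ) * C ^ (1 / 3 : ℝ) ≤ s * D + s⁻¹ ^ 2 * C :=
      rpow_two_thirds_mul_rpow_one_third_le D C hs0 hstop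
    -- the interpolation
    have hCR : C ≤ κ * AA ^ (3 / 4 : ℝ) := hinterp z' R hR0 hQR
    have hCR23 : C ^ (2 / 3 : ℝ) ≤ κ ^ (2 / 3 : ℝ) * AA ^ (1 / 2 : ℝ) := by
      calc C ^ (2 / 3 : ℝ) ≤ (κ * AA ^ (3 / 4 : ℝ)) ^ (2 / 3 : ℝ) :=
          ENNReal.rpow_le_rpow hCR (by norm_num)
        _ = κ ^ (2 / 3 : ℝ) * AA ^ (1 / 2 : ℝ) := by
          rw [ENNReal.mul_rpow_of_nonneg _ _ (by norm_num), ← ENNReal.rpow_mul]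
          norm_num
    -- absorption of the sublinear powers of `AA`
    have hab1 : α₁ * AA ^ (1 / 2 : ℝ) ≤ ε * AA + K₁ :=
      rpow_le_mul_add (by norm_num) (by norm_num) α₁ AA hε0 hεtop
    have hab2 : α₂ * AA ^ (3 / 4 : ℝ) ≤ ε * AA + K₂ :=
      rpow_le_mul_add (by norm_num) (by norm_num) α₂ AA hε0 hεtop
    -- combine
    calc cknAEss (θ * R) z' u + cknD (θ * R) z' p
        ≤ ENNReal.ofReal ((2 * θ)⁻¹) *
            (c₁ * C ^ (2 / 3 : ℝ) + c₂ * C + c₃ * (s * D + s⁻¹ ^ 2 * C)) +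
          c * (ENNReal.ofReal θ * D + ENNReal.ofReal ((θ⁻¹) ^ 2) * C) := by
          gcongr
          exact hA1.trans (by gcongr)
      _ = (L * s) * D + (c * ENNReal.ofReal θ) * D +
          ENNReal.ofReal ((2 * θ)⁻¹) * c₁ * C ^ (2 / 3 : ℝ) +
          (ENNReal.ofReal ((2 * θ)⁻¹) * (c₂ + c₃ * s⁻¹ ^ 2) + c * ENNReal.ofReal (θ⁻¹ ^ 2)) * C := by
          rw [hL]; ring
      _ ≤ (2⁻¹ * 2⁻¹) * D + (2⁻¹ * 2⁻¹) * D +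
          ENNReal.ofReal ((2 * θ)⁻¹) * c₁ * (κ ^ (2 / 3 : ℝ) * AA ^ (1 / 2 : ℝ)) +
          (ENNReal.ofReal ((2 * θ)⁻¹) * (c₂ + c₃ * s⁻¹ ^ 2) + c * ENNReal.ofReal (θ⁻¹ ^ 2)) *
            (κ * AA ^ (3 / 4 : ℝ)) := by
          gcongr
      _ = 2⁻¹ * D + α₁ * AA ^ (1 / 2 : ℝ) + α₂ * AA ^ (3 / 4 : ℝ) := by
          rw [quarter_add_quarter, hα₁, hα₂]; ring
      _ ≤ 2⁻¹ * D + (ε * AA + K₁) + (ε * AA + K₂) := by gcongr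
      _ = 2⁻¹ * D + 2⁻¹ * AA + K₁ + K₂ := by
          rw [hε, ← quarter_add_quarter AA]; ring
      _ = (AA + D) / 2 + b := by
          rw [hb, div_eq_mul_inv]; ring
  -- ### the constants of the conclusion
  set Ψ₀ : ℝ≥0∞ := 2 * b + (A₀ + D₀) with hΨ₀
  have hΨ₀top : Ψ₀ ≠ ∞ := ENNReal.add_ne_top.2
    ⟨ENNReal.mul_ne_top ENNReal.ofNat_ne_top hbtop, ENNReal.add_ne_top.2 ⟨hA₀, hD₀⟩⟩
  set Abar : ℝ≥0∞ := ENNReal.ofReal (θ⁻¹) * Ψ₀ with hAbar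
  have hAbartop : Abar ≠ ∞ := ENNReal.mul_ne_top ENNReal.ofReal_ne_top hΨ₀top
  set M : ℝ≥0∞ := κ * Abar ^ (3 / 4 : ℝ) with hM
  have hMtop : M ≠ ∞ := ENNReal.mul_ne_top hκ (ENNReal.rpow_ne_top_of_nonneg (by norm_num) hAbartop)
  -- a second ratio `θ'` for the pressure iteration, `c θ' ≤ 1/2`
  obtain ⟨θ', hθ', hθ'half, hcθ'⟩ := exists_ratio_mul_le_half c
  have hθ'1 : θ' ≤ 1 := hθ'half.trans (by norm_num)
  set BB : ℝ≥0∞ := D₀ + 2 * (c * ENNReal.ofReal ((θ'⁻¹) ^ 2) * M) with hBB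
  have hBBtop : BB ≠ ∞ := by
    refine ENNReal.add_ne_top.2 ⟨hD₀, ENNReal.mul_ne_top ENNReal.ofNat_ne_top ?_⟩
    exact ENNReal.mul_ne_top (ENNReal.mul_ne_top ENNReal.coe_ne_top ENNReal.ofReal_ne_top) hMtop
  set B' : ℝ≥0∞ := ENNReal.ofReal (θ'⁻¹) ^ 2 * BB with hB'
  have hB'top : B' ≠ ∞ := ENNReal.mul_ne_top (ENNReal.pow_ne_top ENNReal.ofReal_ne_top) hBBtop
  set K : ℝ≥0∞ := c₁ * M ^ (2 / 3 : ℝ) + c₂ * M + c₃ * (B' ^ (2 / 3 : ℝ) * M ^ (1 / 3 : ℝ)) + M + B'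
    with hK
  have hKtop : K ≠ ∞ := by
    have hM23 : M ^ (2 / 3 : ℝ) ≠ ∞ := ENNReal.rpow_ne_top_of_nonneg (by norm_num) hMtop
    have hM13 : M ^ (1 / 3 : ℝ) ≠ ∞ := ENNReal.rpow_ne_top_of_nonneg (by norm_num) hMtop
    have hB23 : B' ^ (2 / 3 : ℝ) ≠ ∞ := ENNReal.rpow_ne_top_of_nonneg (by norm_num) hB'top
    rw [hK]
    refine ENNReal.add_ne_top.2 ⟨ENNReal.add_ne_top.2 ⟨ENNReal.add_ne_top.2
      ⟨ENNReal.add_ne_top.2 ⟨?_, ?_⟩, ?_⟩, hMtop⟩, hB'top⟩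
    · exact ENNReal.mul_ne_top ENNReal.coe_ne_top hM23
    · exact ENNReal.mul_ne_top ENNReal.coe_ne_top hMtop
    · exact ENNReal.mul_ne_top ENNReal.coe_ne_top (ENNReal.mul_ne_top hB23 hM13)
  refine ⟨K, hKtop, fun z' r₀ hr₀ hQ hAr₀ hDr₀ => ?_⟩
  -- ### the iteration along `θᵏ r₀`
  have hiter : ∀ k : ℕ, cknAEss (θ ^ k * r₀) z' u + cknD (θ ^ k * r₀) z' p ≤ Ψ₀ := by
    intro k
    have := iterate_half_le (φ := fun ρ => cknAEss ρ z' u + cknD ρ z' p) hθ hθ1 hr₀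
      (fun R hR0 hRr => step z' R hR0 ((parabolicCylinder_mono hR0.le hRr z').trans hQ)) k
    refine this.trans ?_
    rw [hΨ₀]
    gcongr
    calc (2⁻¹ : ℝ≥0∞) ^ k * (cknAEss r₀ z' u + cknD r₀ z' p) ≤ 1 * (A₀ + D₀) := by
          gcongr
          exact pow_le_one₀ zero_le (ENNReal.inv_le_one.2 one_le_two)
      _ = _ := one_mul _
  -- ### `A` at every radius `0 < r ≤ r₀`
  have hAr : ∀ r ∈ Ioc (0 : ℝ) r₀, cknAEss r z' u ≤ Abar := by
    intro r hr
    obtain ⟨J, hJ1, hJ2⟩ := exists_nat_pow_near_of_lt_one (div_pos hr.1 hr₀)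
      ((div_le_one hr₀).2 hr.2) hθ (by linarith)
    have hle : r ≤ θ ^ J * r₀ := by rwa [div_le_iff₀ hr₀] at hJ2
    have hlt : θ ^ J * r₀ < θ⁻¹ * r := by
      rw [lt_div_iff₀ hr₀] at hJ1
      have : θ ^ J * r₀ = θ⁻¹ * (θ ^ (J + 1) * r₀) := by
        rw [pow_succ]; field_simp
      rw [this]
      exact mul_lt_mul_of_pos_left hJ1 (inv_pos.2 hθ)
    have hI : Ioo (z'.1 - r ^ 2) z'.1 ⊆ Ioo (z'.1 - (θ ^ J * r₀) ^ 2) z'.1 :=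
      Ioo_subset_Ioo (by nlinarith [pow_le_pow_left₀ hr.1.le hle 2]) le_rfl
    have hB : ball z'.2 r ⊆ ball z'.2 (θ ^ J * r₀) := ball_subset_ball hle
    calc cknAEss r z' u ≤ ENNReal.ofReal (θ ^ J * r₀ / r) * cknAEss (θ ^ J * r₀) z' u :=
          cknAEss_le_mul_of_subset (by positivity) hr.1 hI hB u
      _ ≤ ENNReal.ofReal (θ⁻¹) * Ψ₀ := by
          gcongr
          · exact (div_le_iff₀ hr.1).2 hlt.le
          · exact le_self_add.trans (hiter J)
  -- ### `C` bounded by `M` on `]0, r₀]`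
  have hCb : ∀ r ∈ Ioc (0 : ℝ) r₀, cknC r z' u ≤ M := by
    intro r hr
    refine (hinterp z' r hr.1 ((parabolicCylinder_mono hr.1.le hr.2 z').trans hQ)).trans ?_
    rw [hM]
    gcongr
    exact hAr r hr
  -- ### `D` along the scales `θ'ᴶ r₀` and at every radius
  have hDJ : ∀ J : ℕ, cknD (θ' ^ J * r₀) z' p ≤ BB := by
    intro J
    have hCj : ∀ j < J, cknC (θ' ^ j * r₀) z' u ≤ M := fun j _ =>
      hCb _ ⟨by positivity, mul_le_of_le_one_left hr₀.le (pow_le_one₀ hθ'.le hθ'1)⟩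
    refine (cknD_iterate_le_of_pressure_decay hc hθ' hθ'1 hcθ' hsw.distributional hr₀ hQ
      hCj).trans ?_
    rw [hBB]
    gcongr
    calc (2⁻¹ : ℝ≥0∞) ^ J * cknD r₀ z' p ≤ 1 * D₀ := by
          gcongr
          exact pow_le_one₀ zero_le (ENNReal.inv_le_one.2 one_le_two)
      _ = D₀ := one_mul _
  have hDr : ∀ r ∈ Ioc (0 : ℝ) r₀, cknD r z' p ≤ B' := by
    intro r hr
    obtain ⟨J, hJ1, hJ2⟩ := exists_nat_pow_near_of_lt_one (div_pos hr.1 hr₀)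
      ((div_le_one hr₀).2 hr.2) hθ' (by linarith)
    have hle : r ≤ θ' ^ J * r₀ := by rwa [div_le_iff₀ hr₀] at hJ2
    have hlt : θ' ^ J * r₀ < θ'⁻¹ * r := by
      rw [lt_div_iff₀ hr₀] at hJ1
      have : θ' ^ J * r₀ = θ'⁻¹ * (θ' ^ (J + 1) * r₀) := by
        rw [pow_succ]; field_simp
      rw [this]
      exact mul_lt_mul_of_pos_left hJ1 (inv_pos.2 hθ')
    have hsub : parabolicCylinder r z' ⊆ parabolicCylinder (θ' ^ J * r₀) z' :=
      parabolicCylinder_mono hr.1.le hle z'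
    calc cknD r z' p ≤ ENNReal.ofReal (θ' ^ J * r₀ / r) ^ 2 * cknD (θ' ^ J * r₀) z' p :=
          cknD_le_mul_of_subset (by positivity) hr.1 hsub p
      _ ≤ ENNReal.ofReal (θ'⁻¹) ^ 2 * BB := by
          gcongr
          · exact (div_le_iff₀ hr.1).2 hlt.le
          · exact hDJ J
  -- ### conclusion from the local energy bound at `2ρ`
  intro ρ hρ
  have h2r : 2 * ρ ∈ Ioc (0 : ℝ) r₀ := ⟨by linarith [hρ.1], by linarith [hρ.2]⟩
  have hrr : ρ ∈ Ioc (0 : ℝ) r₀ := ⟨hρ.1, by linarith [hρ.2]⟩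
  have hAE := HT Q u p G hsw hG z' (2 * ρ) h2r.1
    ((parabolicCylinder_mono (by linarith [hρ.1]) h2r.2 z').trans hQ)
  rw [show 2 * ρ / 2 = ρ by ring] at hAE
  have hC2 : cknC (2 * ρ) z' u ≤ M := hCb _ h2r
  have hD2 : cknD (2 * ρ) z' p ≤ B' := hDr _ h2r
  calc cknAEss ρ z' u + cknE ρ z' G + cknC ρ z' u + cknD ρ z' p
      ≤ (c₁ * cknC (2 * ρ) z' u ^ (2 / 3 : ℝ) + c₂ * cknC (2 * ρ) z' u +
          c₃ * (cknD (2 * ρ) z' p ^ (2 / 3 : ℝ) * cknC (2 * ρ) z' u ^ (1 / 3 : ℝ))) +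
          M + B' := add_le_add (add_le_add hAE (hCb ρ hrr)) (hDr ρ hrr)
    _ ≤ K := by
        rw [hK]
        gcongr

/-! ### Unit-scale energy data on sub-balls -/

/-- `A(Q(z', ρ)) ≤ ρ⁻¹ C₀` for every sub-ball `Q(z', ρ)` of the unit ball `Q(z, 1)`, from the
energy class `esssup_{t-1<s<t} ∫_{B(x,1)} |u(s)|² ≤ C₀` of Def. 2.1. [cite: AlbrittonBarker2019, Def. 2.1] -/
theorem cknAEss_le_of_energyClass {z : ℝ × EuclideanSpace ℝ (Fin 3)}
    {u : ℝ → EuclideanSpace ℝ (Fin 3) → EuclideanSpace ℝ (Fin 3)} {C₀ : ℝ≥0}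
    (hC₀ : ∀ᵐ s ∂(volume.restrict (Ioo (z.1 - 1 ^ 2) z.1)), ∫⁻ y in ball z.2 1, ‖u s y‖ₑ ^ 2 ≤ C₀)
    {z' : ℝ × EuclideanSpace ℝ (Fin 3)} {ρ : ℝ} (hρ : 0 < ρ)
    (hsub : parabolicCylinder ρ z' ⊆ parabolicCylinder 1 z) :
    cknAEss ρ z' u ≤ (ENNReal.ofReal ρ)⁻¹ * C₀ := by
  have hI' : (Ioo (z'.1 - ρ ^ 2) z'.1).Nonempty := nonempty_Ioo.2 (by nlinarith)
  have hB' : (ball z'.2 ρ).Nonempty := nonempty_ball.2 hρ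
  obtain ⟨hI, hB⟩ : Ioo (z'.1 - ρ ^ 2) z'.1 ⊆ Ioo (z.1 - 1 ^ 2) z.1 ∧ ball z'.2 ρ ⊆ ball z.2 1 := by
    rcases prod_subset_prod_iff.1 hsub with h1 | h1 | h1
    · exact h1
    · exact absurd h1 hI'.ne_empty
    · exact absurd h1 hB'.ne_empty
  refine essSup_le_of_ae_le _ ?_
  filter_upwards [ae_restrict_of_ae_restrict_of_subset hI hC₀] with s hs
  exact mul_le_mul' le_rfl ((lintegral_mono_set hB).trans hs)

/-- `x ≤ 4x` in `ℝ≥0∞`. [folklore] -/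
theorem le_four_mul (x : ℝ≥0∞) : x ≤ 4 * x := by
  calc x = 1 * x := (one_mul x).symm
    _ ≤ 4 * x := by gcongr; norm_num

end AlbrittonBarker2019

open AlbrittonBarker2019 in
/-- **Albritton–Barker 2019, Lemma 2.5 with Remark 3.2 (weak Serrin implies Type I), the
`L^∞`-rate case — discharge of `albrittonBarker2019_lemma_2_5_rate`.** A suitable weak solution
`(u, p)` of Navier–Stokes in `Q(z, 1)` (Def. 2.1) with `|u(s, y)| ≤ C/√(t - s)` there has
`𝐈(Q(z, R)) < ∞` for every `0 < R < 1` and every weak spatial gradient `G` of `u` on the ball.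
Proof: module docstring (rate interpolation `C ≤ κ A^{3/4}` + Seregin's iteration with
constants uniform in the centre + unit-scale data). [cite: AlbrittonBarker2019, Lemma 2.5 and Remark 3.2 (arXiv:1811.00502 §2, §3)] -/
theorem albrittonBarker2019_lemma_2_5_rate_holds : albrittonBarker2019_lemma_2_5_rate := by
  intro z u p C hswB hrate G hG R hR0 hR1
  obtain ⟨hsw, ⟨C₀, hC₀⟩, ⟨G₀, hG₀, hG₀fin⟩, hp⟩ := hswB
  -- the domain and the room `δ`
  set Q : Opens (ℝ × EuclideanSpace ℝ (Fin 3)) := parabolicCylinderOpens 1 z with hQdef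
  have hQ : (Q : Set (ℝ × EuclideanSpace ℝ (Fin 3))) = parabolicCylinder 1 z := rfl
  set δ : ℝ := 1 - R with hδ
  have hδ0 : 0 < δ := by rw [hδ]; linarith
  -- the rate with a nonnegative constant
  have hrate' : ∀ s y, (s, y) ∈ parabolicCylinder 1 z → ‖u s y‖ ≤ |C| / Real.sqrt (z.1 - s) :=
    fun s y h => (hrate s y h).trans
      (div_le_div_of_nonneg_right (le_abs_self C) (Real.sqrt_nonneg _))
  -- measurability of `u` and `p` on the unit ball
  have hu : AEStronglyMeasurable (uncurry u) (volume.restrict (parabolicCylinder 1 z)) :=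
    hsw.distributional.1.aestronglyMeasurable
  have hpm : AEStronglyMeasurable (uncurry p) (volume.restrict (parabolicCylinder 1 z)) :=
    hp.aestronglyMeasurable
  -- ### the rate interpolation on every sub-ball
  set κ : ℝ≥0∞ := 4 * volume (ball (0 : EuclideanSpace ℝ (Fin 3)) 1) ^ (1 / 4 : ℝ) *
    ENNReal.ofReal (|C| ^ (3 / 2 : ℝ)) with hκ
  have hκtop : κ ≠ ∞ := ENNReal.mul_ne_top (ENNReal.mul_ne_top ENNReal.ofNat_ne_top
    (ENNReal.rpow_ne_top_of_nonneg (by norm_num) measure_ball_lt_top.ne)) ENNReal.ofReal_ne_top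
  have hinterp : ∀ (z' : ℝ × EuclideanSpace ℝ (Fin 3)) (ρ : ℝ), 0 < ρ →
      parabolicCylinder ρ z' ⊆ (Q : Set (ℝ × EuclideanSpace ℝ (Fin 3))) →
      cknC ρ z' u ≤ κ * cknAEss ρ z' u ^ (3 / 4 : ℝ) := fun z' ρ hρ hsub =>
    cknC_le_of_rate (abs_nonneg C) hu hrate' hρ (by rwa [hQ] at hsub)
  -- ### unit-scale data
  set P₁ : ℝ≥0∞ := ∫⁻ w in parabolicCylinder 1 z, ‖p w.1 w.2‖ₑ ^ (3 / 2 : ℝ) with hP₁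
  have hP₁top : P₁ ≠ ∞ := by
    have h := lintegral_rpow_enorm_lt_top_of_eLpNorm_lt_top
      (zero_lt_one.trans_le threeHalves_facts.1).ne' threeHalves_facts.2.1 hp.eLpNorm_lt_top
    rw [threeHalves_facts.2.2] at h
    exact h.ne
  set E₁ : ℝ≥0∞ := ∫⁻ w in parabolicCylinder 1 z, ENNReal.ofReal (frobeniusNormSq (G w.1 w.2))
    with hE₁
  have hE₁top : E₁ ≠ ∞ := by
    have heq : E₁ = ∫⁻ w in parabolicCylinder 1 z,
        ENNReal.ofReal (frobeniusNormSq (G₀ w.1 w.2)) := by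
      refine lintegral_congr_ae ?_
      filter_upwards [hG₀.ae_eq hG] with w hw
      change G₀ w.1 w.2 = G w.1 w.2 at hw
      rw [hw]
    rw [heq]
    exact hG₀fin.ne
  have hδi : (ENNReal.ofReal δ)⁻¹ ≠ ∞ := ENNReal.inv_ne_top.2 (ENNReal.ofReal_pos.2 hδ0).ne'
  have hδi2 : (ENNReal.ofReal δ ^ 2)⁻¹ ≠ ∞ :=
    ENNReal.inv_ne_top.2 (pow_ne_zero _ (ENNReal.ofReal_pos.2 hδ0).ne')
  set A₀ : ℝ≥0∞ := (ENNReal.ofReal δ)⁻¹ * C₀ with hA₀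
  have hA₀top : A₀ ≠ ∞ := ENNReal.mul_ne_top hδi ENNReal.coe_ne_top
  set D₀ : ℝ≥0∞ := (ENNReal.ofReal δ ^ 2)⁻¹ * P₁ with hD₀
  have hD₀top : D₀ ≠ ∞ := ENNReal.mul_ne_top hδi2 hP₁top
  set E₀ : ℝ≥0∞ := (ENNReal.ofReal δ)⁻¹ * E₁ with hE₀
  have hE₀top : E₀ ≠ ∞ := ENNReal.mul_ne_top hδi hE₁top
  -- the data of a sub-ball `Q(z', ρ) ⊆ Q(z, 1)` of radius `ρ ≥ δ`
  have hdataA : ∀ (z' : ℝ × EuclideanSpace ℝ (Fin 3)) (ρ : ℝ), δ ≤ ρ →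
      parabolicCylinder ρ z' ⊆ parabolicCylinder 1 z → cknAEss ρ z' u ≤ A₀ := by
    intro z' ρ hδρ hsub
    have hρ : 0 < ρ := hδ0.trans_le hδρ
    refine (cknAEss_le_of_energyClass hC₀ hρ hsub).trans ?_
    rw [hA₀]
    exact mul_le_mul' (ENNReal.inv_le_inv.2 (ENNReal.ofReal_le_ofReal hδρ)) le_rfl
  have hdataD : ∀ (z' : ℝ × EuclideanSpace ℝ (Fin 3)) (ρ : ℝ), δ ≤ ρ →
      parabolicCylinder ρ z' ⊆ parabolicCylinder 1 z → cknD ρ z' p ≤ D₀ := by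
    intro z' ρ hδρ hsub
    rw [cknD, hD₀]
    refine mul_le_mul' (ENNReal.inv_le_inv.2 ?_) (lintegral_mono_set hsub)
    gcongr
  have hdataE : ∀ (z' : ℝ × EuclideanSpace ℝ (Fin 3)) (ρ : ℝ), δ ≤ ρ →
      parabolicCylinder ρ z' ⊆ parabolicCylinder 1 z → cknE ρ z' G ≤ E₀ := by
    intro z' ρ hδρ hsub
    rw [cknE, hE₀]
    exact mul_le_mul' (ENNReal.inv_le_inv.2 (ENNReal.ofReal_le_ofReal hδρ))
      (lintegral_mono_set hsub)
  -- ### the uniform bound on small balls and the bound on large balls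
  obtain ⟨K, hKtop, hK⟩ := uniform_bound_of_interp hsw hG hκtop hinterp hA₀top hD₀top
  set Kbig : ℝ≥0∞ := A₀ + κ * A₀ ^ (3 / 4 : ℝ) + 4 * D₀ + E₀ with hKbig
  have hKbigtop : Kbig ≠ ∞ := by
    refine ENNReal.add_ne_top.2 ⟨ENNReal.add_ne_top.2 ⟨ENNReal.add_ne_top.2 ⟨hA₀top, ?_⟩, ?_⟩,
      hE₀top⟩
    · exact ENNReal.mul_ne_top hκtop (ENNReal.rpow_ne_top_of_nonneg (by norm_num) hA₀top)
    · exact ENNReal.mul_ne_top ENNReal.ofNat_ne_top hD₀top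
  have htop : 4 * K + Kbig < ∞ :=
    (ENNReal.add_ne_top.2 ⟨ENNReal.mul_ne_top ENNReal.ofNat_ne_top hKtop, hKbigtop⟩).lt_top
  -- ### conclusion
  refine lt_of_le_of_lt (typeIBound_le_iff.2 fun r hr z' hzr => ?_) htop
  -- room: `Q(z', ρ) ⊆ Q(z, 1)` for `ρ ≤ r + δ`
  have hroom : ∀ ρ, 0 < ρ → ρ ≤ r + δ → parabolicCylinder ρ z' ⊆ parabolicCylinder 1 z :=
    fun ρ hρ0 hρ => parabolicCylinder_subset_one_of_subset hr hR1.le hzr hρ0 (by rwa [hδ] at hρ)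
  have hsub1 : parabolicCylinder r z' ⊆ parabolicCylinder 1 z := hroom r hr (by linarith)
  -- `D_osc ≤ 4 D` on the ball
  have hOsc : cknDOsc r z' p ≤ 4 * cknD r z' p :=
    cknDOsc_le_four_mul_cknD hr (hpm.mono_measure (Measure.restrict_mono hsub1 le_rfl))
  rw [abScaledSum]
  rcases le_or_gt r δ with hrδ | hrδ
  · -- small ball: the iteration started from `r₀ = r + δ ∈ [δ, 2δ]`
    have hr₀ : 0 < r + δ := by linarith
    have hsub₀ := hroom (r + δ) hr₀ le_rfl
    have hKr := hK z' (r + δ) hr₀ (by rw [hQ]; exact hsub₀) (hdataA z' _ (by linarith) hsub₀)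
      (hdataD z' _ (by linarith) hsub₀) r ⟨hr, by linarith⟩
    calc cknAEss r z' u + cknC r z' u + cknDOsc r z' p + cknE r z' G
        ≤ 4 * cknAEss r z' u + 4 * cknC r z' u + 4 * cknD r z' p + 4 * cknE r z' G :=
          add_le_add (add_le_add (add_le_add (le_four_mul _) (le_four_mul _)) hOsc) (le_four_mul _)
      _ = 4 * (cknAEss r z' u + cknE r z' G + cknC r z' u + cknD r z' p) := by ring
      _ ≤ 4 * K := by gcongr
      _ ≤ 4 * K + Kbig := le_self_add
  · -- large ball: unit-scale data
    have hA := hdataA z' r hrδ.le hsub1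
    have hC : cknC r z' u ≤ κ * A₀ ^ (3 / 4 : ℝ) :=
      (hinterp z' r hr (by rw [hQ]; exact hsub1)).trans (by gcongr)
    calc cknAEss r z' u + cknC r z' u + cknDOsc r z' p + cknE r z' G
        ≤ A₀ + κ * A₀ ^ (3 / 4 : ℝ) + 4 * D₀ + E₀ := by
          gcongr
          · exact hOsc.trans (mul_le_mul' le_rfl (hdataD z' r hrδ.le hsub1))
          · exact hdataE z' r hrδ.le hsub1
      _ = Kbig := by rw [hKbig]
      _ ≤ 4 * K + Kbig := le_add_self

end Literature.Analysis.FluidPDE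

end
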